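import Summits.NavierStokesRegularity.NavierStokesRegularity.Theorems.ExtremiserTransienceAxialOscillationStep
import Literature.Analysis.FluidPDE.KNSSLineInvariantLiouville
import Literature.Analysis.FluidPDE.OseenMildUniqueness
import HarnessLib

/-!
# Route `ExtremiserTransience`, crux `NearExtremalTransiencePerFlow` (stmt-NavierStokesRegularity-26567), rung R1
# `PeriodicFilamentLiouville` of LINE g9-β `filament_selection` — IV: THE LIOUVILLE THEOREM FOR AXIALLY PERIODIC
# TYPE-I ANCIENT MILD SOLUTIONS

Theorems file (`--supports stmt-NavierStokesRegularity-26567`).  MAIN RESULT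
(`eq_zero_of_isTypeIAncientMild_of_isAxiallyPeriodic`): a Type-I ancient mild solution of Navier–Stokes on
`(−∞,0) × ℝ³` in the Oseen (KNSS) gauge — `IsTypeIAncientMild C W`: jointly smooth, divergence free,
`W(t) = e^{(t−s)Δ}W(s) − B¹_s(W,W)(t)` for all `s < t < 0`, `‖W(t,x)‖ ≤ C/√(−t)` — all of whose slices are
axially periodic with one period `ℓ > 0` IS IDENTICALLY ZERO.  No local-energy / linear-growth hypothesis is
needed (the rung `PeriodicFilamentLiouville` of the line card, which carries one, follows a fortiori:
`ExtremiserTransiencePeriodicFilamentLiouville`).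

Proof.  (1) BACKWARD EXTINCTION OF THE AXIAL OSCILLATION (`exists_eq_axialAvg_of_isAxiallyPeriodic`): with
`W̃ = W −` (axial average), the one-step estimate `norm_axialOsc_le_step` (file III) at `h = 1` reads
`sup ‖W̃(t)‖ ≤ θ sup ‖W̃(t−1)‖ + 8 C_B (C/√T₀) sup_{[t−1,t]} ‖W̃‖` on `t ≤ −T₀`, with the STRICT heat-flow
contraction factor `θ = θ(1, ℓ) < 1` of tools II; choosing `√T₀ ≥ 16 C_B C/(1−θ)` the sup of `‖W̃‖` over
`(−∞,−T₀] × ℝ³` (finite: `≤ 2C/√T₀`) is `≤ ρⁿ · 2C/√T₀` for every `n`, `ρ = (1+θ)/2 < 1`, hence zero: `W = W̄`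
is invariant under ALL axial translations for `t ≤ −T₀`.  (2) The shifted field `t ↦ W(t − T₀)` is a jointly
continuous BOUNDED ancient mild solution (`IsTypeIAncientMild.isBoundedAncientMildSolution_sub`) invariant along
`e_z`, so every slice is spatially constant by the tree's line-invariant Liouville theorem
`apply_eq_apply_zero_of_invariant_along` (Koch–Nadirashvili–Seregin–Šverák 2009, Thm 5.1 with §4 and Lemma 2.1,
DISCHARGED in `KNSSLineInvariantLiouville`), hence zero by the Type-I decay
(`IsTypeIAncientMild.eq_zero_of_slice_const`): `W ≡ 0` on `(−∞, −T₀)`.  (3) Forward uniqueness of bounded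
Oseen-mild solutions (`oseenMild_bounded_unique`) from the zero slice at `s = −T₀ − 1` gives `W(t) = 0` a.e. for
`−T₀ ≤ t < 0`, everywhere by continuity.
Consistency checks: 2D (axially constant) Type-I ancient mild fields are zero (KNSS 2009 Thm 5.1 + Type-I
decay) — a special case; the periodic Beltrami flows `e^{−t}·ABC` are ancient and axially periodic but not
Type-I.  HONEST FRAMING: a Liouville theorem for a class of hypothetical blow-up profiles; nothing about
Navier–Stokes regularity or blow-up is proved; no summit is proved by a line. [folklore]
-/

noncomputable section

open MeasureTheory Set Function Filter Metric intervalIntegral Topology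
open Literature.Analysis Literature.Analysis.FluidPDE
open scoped RealInnerProductSpace ENNReal

namespace Summit.NavierStokesRegularity.NavierStokesRegularity.Theorems.AxiallyPeriodicLiouville
-- the summit's namespace `Summit.NavierStokesRegularity.NavierStokesRegularity` repeats the problem name by convention (D-0017)
set_option linter.dupNamespace false

/-! ## Part V — backward extinction of the axial oscillation, and the Liouville theorem -/

section Liouville

/-- The heat flow of the zero field is zero. [folklore] -/
theorem heatFlow_zero_fun {F : Type*} [NormedAddCommGroup F] [NormedSpace ℝ F] (σ : ℝ)
    (x : EuclideanSpace ℝ (Fin 3)) : heatFlow (fun _ : EuclideanSpace ℝ (Fin 3) => (0 : F)) σ x = 0 := by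
  rcases le_or_gt σ 0 with hσ | hσ
  · rw [heatFlow_of_nonpos _ hσ]
  · rw [heatFlow_of_pos _ hσ, UnboundedOperators.heatExtension_zero_fun]
    rfl

/-- **Backward extinction of the axial oscillation.**  An axially `ℓ`-periodic Type-I ancient mild solution
coincides with its axial average at all sufficiently negative times: there is `T₀ > 0` with
`W(t, x) = ℓ⁻¹ ∫₀^ℓ W(t, x + s e_z) ds` for all `t ≤ −T₀` and all `x`.  Proof: by `norm_axialOsc_le_step` with
`h = 1`, the sup of the oscillation over `(−∞, −T₀] × ℝ³` contracts by the factor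
`ρ = θ + 8 C_B C/√T₀ < 1` at each unit time step once `√T₀ ≥ 16 C_B C/(1 − θ)` (the Type-I rate `C/√(−t)`
makes the nonlinearity perturbative far back in time at the fixed length scale `ℓ`); iterating, the sup is
`≤ ρⁿ · 2C/√T₀` for every `n`. [folklore] -/
theorem exists_eq_axialAvg_of_isAxiallyPeriodic
    {W : ℝ → EuclideanSpace ℝ (Fin 3) → EuclideanSpace ℝ (Fin 3)} {C ℓ : ℝ} (hW : IsTypeIAncientMild C W)
    (hℓ : 0 < ℓ) (hper : ∀ t < 0, IsAxiallyPeriodic ℓ (W t)) :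
    ∃ T₀ : ℝ, 0 < T₀ ∧ ∀ t ≤ -T₀, ∀ x : EuclideanSpace ℝ (Fin 3),
      W t x = ℓ⁻¹ • ∫ r in (0 : ℝ)..ℓ, W t (x + r • eZ) := by
  -- the Oseen–Duhamel constant at `ν = 1`
  obtain ⟨Cₒ, hCₒpos, hCₒ'⟩ := exists_norm_oseenDuhamel_le_mul (E := EuclideanSpace ℝ (Fin 3))
  have hCₒ : ∀ (u v : ℝ → EuclideanSpace ℝ (Fin 3) → EuclideanSpace ℝ (Fin 3)) (s t Mu Mv : ℝ),
      s < t → 0 ≤ Mu → 0 ≤ Mv →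
      (∀ τ ∈ Ioo s t, ∀ y, ‖u τ y‖ ≤ Mu) → (∀ τ ∈ Ioo s t, ∀ y, ‖v τ y‖ ≤ Mv) →
      ∀ x, ‖oseenDuhamel 1 s u v t x‖ ≤ Cₒ * Mu * Mv * (2 * Real.sqrt (t - s)) := by
    intro u v s t Mu Mv hst hMu hMv hu hv x
    have := hCₒ' one_pos hst hMu hMv hu hv x
    simpa only [Real.one_rpow, mul_one] using this
  -- the contraction factor at `h = 1`
  set θ : ℝ := 1 - (4 * Real.pi * 1) ^ (-(3 : ℝ) / 2) * Real.exp (-(ℓ ^ 2 / (8 * 1))) *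
      (volume (Metric.ball (0 : EuclideanSpace ℝ (Fin 3)) (ℓ / 2))).toReal with hθ_def
  have hθ1 : θ < 1 := heatFlowAxialFactor_lt_one hℓ one_pos
  set θ' : ℝ := max θ 0 with hθ'_def
  have hθ'1 : θ' < 1 := max_lt hθ1 one_pos
  have hθ'0 : 0 ≤ θ' := le_max_right _ _
  have hθθ' : θ ≤ θ' := le_max_left _ _
  set ρ : ℝ := (1 + θ') / 2 with hρ_def
  have hρ0 : 0 ≤ ρ := by rw [hρ_def]; linarith
  have hρ1 : ρ < 1 := by rw [hρ_def]; linarith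
  have hC0 : 0 ≤ C := hW.nonneg
  -- the threshold time
  set a : ℝ := 16 * Cₒ * C / (1 - θ') with ha_def
  have ha0 : 0 ≤ a := by rw [ha_def]; exact div_nonneg (by positivity) (by linarith)
  set T₀ : ℝ := a ^ 2 + 1 with hT₀_def
  have hT₀ : 0 < T₀ := by rw [hT₀_def]; positivity
  have hsqT : a ≤ Real.sqrt T₀ := by
    rw [hT₀_def]
    calc a = Real.sqrt (a ^ 2) := (Real.sqrt_sq ha0).symm
      _ ≤ Real.sqrt (a ^ 2 + 1) := Real.sqrt_le_sqrt (by linarith)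
  have hsqT0 : 0 < Real.sqrt T₀ := Real.sqrt_pos.2 hT₀
  -- the smallness of the nonlinearity far back in time
  have hsmall : 8 * Cₒ * (C / Real.sqrt T₀) * Real.sqrt 1 ≤ (1 - θ') / 2 := by
    rw [Real.sqrt_one, mul_one]
    have h1 : 16 * Cₒ * C ≤ (1 - θ') * Real.sqrt T₀ := by
      have := mul_le_mul_of_nonneg_left hsqT (by linarith : (0 : ℝ) ≤ 1 - θ')
      rwa [ha_def, mul_div_cancel₀ _ (by linarith : (1 : ℝ) - θ' ≠ 0)] at this
    calc 8 * Cₒ * (C / Real.sqrt T₀) = (8 * Cₒ * C) / Real.sqrt T₀ := by ring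
      _ ≤ ((1 - θ') / 2 * Real.sqrt T₀) / Real.sqrt T₀ :=
          div_le_div_of_nonneg_right (by nlinarith [h1]) hsqT0.le
      _ = (1 - θ') / 2 := mul_div_cancel_right₀ _ hsqT0.ne'
  -- uniform bounds on `(−∞, −T₀]`
  set B₀ : ℝ := 2 * C / Real.sqrt T₀ with hB₀_def
  have hWbd : ∀ τ < 0, τ ≤ -T₀ → ∀ y, ‖W τ y‖ ≤ C / Real.sqrt T₀ := by
    intro τ hτ hτT y
    refine (hW.norm_le hτ y).trans ?_
    exact div_le_div_of_nonneg_left hC0 hsqT0 (Real.sqrt_le_sqrt (by linarith))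
  -- ### the induction: `sup_{(−∞,−T₀] × ℝ³} ‖W̃‖ ≤ ρⁿ B₀`
  have hP : ∀ n : ℕ, ∀ t ≤ -T₀, ∀ x : EuclideanSpace ℝ (Fin 3),
      ‖W t x - ℓ⁻¹ • ∫ r in (0 : ℝ)..ℓ, W t (x + r • eZ)‖ ≤ ρ ^ n * B₀ := by
    intro n
    induction n with
    | zero =>
      intro t ht x
      have ht0 : t < 0 := by linarith
      rw [pow_zero, one_mul]
      calc ‖W t x - ℓ⁻¹ • ∫ r in (0 : ℝ)..ℓ, W t (x + r • eZ)‖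
          ≤ ‖W t x‖ + ‖ℓ⁻¹ • ∫ r in (0 : ℝ)..ℓ, W t (x + r • eZ)‖ := norm_sub_le _ _
        _ ≤ C / Real.sqrt T₀ + C / Real.sqrt T₀ :=
            add_le_add (hWbd t ht0 ht x) (norm_axialAvg_le hℓ (hWbd t ht0 ht) x)
        _ = B₀ := by rw [hB₀_def]; ring
    | succ n ih =>
      intro t ht x
      have ht0 : t < 0 := by linarith
      have hstep := norm_axialOsc_le_step hW hℓ hper hCₒ one_pos ht0 (M := C / Real.sqrt T₀) (D := ρ ^ n * B₀)
        (by positivity) (by positivity)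
        (fun τ hτ y => hWbd τ (hτ.2.trans ht0) (by linarith [hτ.2]) y)
        (fun τ hτ y => ih τ (by linarith [hτ.2]) y) x
      calc ‖W t x - ℓ⁻¹ • ∫ r in (0 : ℝ)..ℓ, W t (x + r • eZ)‖
          ≤ θ * (ρ ^ n * B₀) + 8 * Cₒ * (C / Real.sqrt T₀) * Real.sqrt 1 * (ρ ^ n * B₀) := hstep
        _ ≤ θ' * (ρ ^ n * B₀) + (1 - θ') / 2 * (ρ ^ n * B₀) :=
            add_le_add (mul_le_mul_of_nonneg_right hθθ' (by positivity))
              (mul_le_mul_of_nonneg_right hsmall (by positivity))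
        _ = ρ ^ (n + 1) * B₀ := by rw [hρ_def, pow_succ]; ring
  -- ### conclusion
  refine ⟨T₀, hT₀, fun t ht x => ?_⟩
  have hlim : Tendsto (fun n : ℕ => ρ ^ n * B₀) atTop (𝓝 (0 * B₀)) :=
    (tendsto_pow_atTop_nhds_zero_of_lt_one hρ0 hρ1).mul_const B₀
  rw [zero_mul] at hlim
  have h0 : ‖W t x - ℓ⁻¹ • ∫ r in (0 : ℝ)..ℓ, W t (x + r • eZ)‖ ≤ 0 :=
    ge_of_tendsto' hlim fun n => hP n t ht x
  exact sub_eq_zero.1 (norm_le_zero_iff.1 h0)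

/-- **Liouville theorem for axially periodic Type-I ancient mild solutions.**  A Type-I ancient mild solution
of the Navier–Stokes equations on `(−∞, 0) × ℝ³` in the Oseen (KNSS) gauge (`IsTypeIAncientMild C W`) all of
whose slices are axially periodic with one period `ℓ > 0` (`W(t, x + ℓ e_z) = W(t, x)`) vanishes identically.
Proof: by `exists_eq_axialAvg_of_isAxiallyPeriodic` the field is invariant under ALL axial translations for
`t ≤ −T₀`; the time-shifted field `t ↦ W(t − T₀)` is then a jointly continuous bounded ancient mild solution
invariant along `e_z`, hence spatially constant on every slice by the tree's line-invariant Liouville theorem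
(`apply_eq_apply_zero_of_invariant_along`: KNSS 2009, Thm 5.1 + §4 + Lemma 2.1), hence zero by the Type-I
decay (`IsTypeIAncientMild.eq_zero_of_slice_const`); forward uniqueness of bounded Oseen-mild solutions
(`oseenMild_bounded_unique`) propagates `W = 0` up to `t = 0`.  NO local-energy (linear-growth) hypothesis is
needed. [folklore] -/
theorem eq_zero_of_isTypeIAncientMild_of_isAxiallyPeriodic
    {W : ℝ → EuclideanSpace ℝ (Fin 3) → EuclideanSpace ℝ (Fin 3)} {C ℓ : ℝ} (hW : IsTypeIAncientMild C W)
    (hℓ : 0 < ℓ) (hper : ∀ t < 0, IsAxiallyPeriodic ℓ (W t)) :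
    ∀ t < 0, ∀ x : EuclideanSpace ℝ (Fin 3), W t x = 0 := by
  obtain ⟨T₀, hT₀, havg⟩ := exists_eq_axialAvg_of_isAxiallyPeriodic hW hℓ hper
  have hC0 : 0 ≤ C := hW.nonneg
  -- axial invariance for `t ≤ −T₀`
  have hinv : ∀ t ≤ -T₀, ∀ (x : EuclideanSpace ℝ (Fin 3)) (δ : ℝ), W t (x + δ • eZ) = W t x := by
    intro t ht x δ
    have ht0 : t < 0 := by linarith
    rw [havg t ht (x + δ • eZ), havg t ht x]
    exact axialAvg_add_smul_eZ (hper t ht0) x δ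
  -- the shifted field is a bounded ancient mild solution invariant along `e_z`, hence zero
  set V : ℝ → EuclideanSpace ℝ (Fin 3) → EuclideanSpace ℝ (Fin 3) := fun t x => W (t - T₀) x with hV_def
  have hV : IsTypeIAncientMild C V := hW.comp_sub_right hT₀.le
  have hVb : IsBoundedAncientMildSolution 1 V := hW.isBoundedAncientMildSolution_sub hT₀
  have hVinv : ∀ t < 0, ∀ (x : EuclideanSpace ℝ (Fin 3)) (δ : ℝ), V t (x + δ • eZ) = V t x :=
    fun t ht x δ => hinv (t - T₀) (by linarith) x δ
  have heZ : (eZ : EuclideanSpace ℝ (Fin 3)) ≠ 0 := by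
    intro h0
    have := congrArg (fun v : EuclideanSpace ℝ (Fin 3) => v 2) h0
    simp [eZ] at this
  have hVconst := apply_eq_apply_zero_of_invariant_along heZ hVb hV.continuousOn_uncurry hVinv
  have hV0 : ∀ t < 0, ∀ x, V t x = 0 := fun t ht x =>
    hV.eq_zero_of_slice_const (b := fun t => V t 0) hVconst ht x
  have hWearly : ∀ τ < -T₀, ∀ x : EuclideanSpace ℝ (Fin 3), W τ x = 0 := by
    intro τ hτ x
    have := hV0 (τ + T₀) (by linarith) x
    simpa only [hV_def, add_sub_cancel_right] using this
  -- forward uniqueness of bounded Oseen-mild solutions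
  intro t ht x
  by_cases hte : t < -T₀
  · exact hWearly t hte x
  push Not at hte
  set s : ℝ := -T₀ - 1 with hs_def
  have hs : s < -T₀ := by rw [hs_def]; linarith
  have hst : s < t := by linarith
  set T : ℝ := t / 2 with hT_def
  have htT : t < T := by rw [hT_def]; linarith
  have hT0 : T < 0 := by rw [hT_def]; linarith
  have hWs0 : W s = fun _ => 0 := funext fun y => hWearly s hs y
  have hM : ∀ τ ∈ Ioo s T, ∀ y, ‖W τ y‖ ≤ C / Real.sqrt (-T) := fun τ hτ y => hW.norm_le_of_mem_Ioo hT0 hτ y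
  have hM0 : 0 ≤ C / Real.sqrt (-T) := by positivity
  have hzero_bd : ∀ τ ∈ Ioo s T, ∀ y : EuclideanSpace ℝ (Fin 3),
      ‖(0 : ℝ → EuclideanSpace ℝ (Fin 3) → EuclideanSpace ℝ (Fin 3)) τ y‖ ≤ C / Real.sqrt (-T) := by
    intro τ _ y
    simpa using hM0
  have hu : ∀ τ ∈ Ioo s T, W τ =ᵐ[volume] fun y =>
      (0 : ℝ → EuclideanSpace ℝ (Fin 3) → EuclideanSpace ℝ (Fin 3)) τ y - oseenDuhamel 1 s W W τ y := by
    intro τ hτ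
    refine Eventually.of_forall fun y => ?_
    have hmild := hW.mild_eq hτ.1 (hτ.2.trans hT0) y
    rw [hWs0, heatFlow_zero_fun] at hmild
    rw [hmild]
    simp
  have hv : ∀ τ ∈ Ioo s T, (0 : ℝ → EuclideanSpace ℝ (Fin 3) → EuclideanSpace ℝ (Fin 3)) τ =ᵐ[volume] fun y =>
      (0 : ℝ → EuclideanSpace ℝ (Fin 3) → EuclideanSpace ℝ (Fin 3)) τ y -
        oseenDuhamel 1 s (0 : ℝ → EuclideanSpace ℝ (Fin 3) → EuclideanSpace ℝ (Fin 3)) 0 τ y := by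
    intro τ _
    refine Eventually.of_forall fun y => ?_
    simp
  have h0m : AEStronglyMeasurable (uncurry (0 : ℝ → EuclideanSpace ℝ (Fin 3) → EuclideanSpace ℝ (Fin 3)))
      ((volume : Measure (ℝ × EuclideanSpace ℝ (Fin 3))).restrict (Ioo s T ×ˢ univ)) :=
    aestronglyMeasurable_const
  have huniq := oseenMild_bounded_unique one_pos hM0 (hW.aestronglyMeasurable_uncurry hT0.le) h0m hM hzero_bd hu hv
  have hae : W t =ᵐ[volume] (0 : ℝ → EuclideanSpace ℝ (Fin 3) → EuclideanSpace ℝ (Fin 3)) t := huniq t ⟨hst, htT⟩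
  have heq : W t = (0 : ℝ → EuclideanSpace ℝ (Fin 3) → EuclideanSpace ℝ (Fin 3)) t :=
    (Continuous.ae_eq_iff_eq volume (hW.continuous_slice ht) continuous_const).1 hae
  rw [heq]
  rfl

end Liouville

end Summit.NavierStokesRegularity.NavierStokesRegularity.Theorems.AxiallyPeriodicLiouville

end
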